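import Mathlib.RingTheory.MvPolynomial.WeightedHomogeneous
import Mathlib.RingTheory.MvPolynomial.Basic
import Mathlib.RingTheory.Ideal.Operations
import Mathlib.Algebra.BigOperators.Fin
import HarnessLib

/-!
# Veronese splitting for the weights `(2,6,9)` and `N = 18` — the corner-G1 calibration
(crux `FInjectiveMacaulayfication`, line `graded-engine`, calibration G6d)

[OURS · L1 W4.5a] Support file for crux stmt-ResolutionOfSingularities-15315
(`Summit.ResolutionOfSingularities.ResolutionOfSingularities.Theses.FrobeniusLadder.FInjectiveMacaulayfication`,
route `FrobeniusLadder`, registered skeleton v11 `86e9127b5c98b8e6`, line `graded-engine`, calibration G6d of CHAIN w45a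
v3.8 = tri-1's corner-G1 specimen `g = z² + x³y² + y³`, TRIAGE §10): the Veronese-saturation hypothesis of the graded
engine (G5 `stub_gradedConeFiModel`) for the weights `w = (2, 6, 9)` on `(X₀, X₁, X₂) = (x, y, z)` and `N = 18`
(`c = (9, 3, 2)`; `g` is weighted homogeneous of degree `18`).

Let `I₁₈ ⊆ k[X₀,X₁,X₂]` be the ideal spanned by the monomials `X^b` of weighted degree `2b₀ + 6b₁ + 9b₂ ≥ 18`.
**Veronese splitting**: every monomial of weighted degree `≥ 18K` lies in `I₁₈^K`.

Proof. Induction on `K` through the exponent-vector statement `coord_split`: if `(K+1)·18 ≤ w·a` then `a = b + c`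
with `18 ≤ w·b` and `K·18 ≤ w·c`. PEEL a pure block `x⁹`, `y³`, `z²` (weight exactly `18`) when an exponent is large;
otherwise `a` lies in the box `a₀ ≤ 8, a₁ ≤ 2, a₂ ≤ 1` of weight `≤ 37 < 54`, so `K ≤ 1`; `K = 0` is trivial and for
`K = 1` (weight `≥ 36` forces `a = (8,2,1)`, weight `37`) the mixed block `x³y²` (weight `18`) divides, with cofactor
`x⁵z` of weight `19 ≥ 18` (a linear-arithmetic fact, `omega`). All glue on Mathlib (`Finsupp.weight_apply`,
`Fin.sum_univ_three`, `MvPolynomial.monomial_mul`, `Ideal.mul_mem_mul`); template: `BP237VeroneseSplitting` (p465729,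
weights `(14,6,21)`). AI-written; weaker than expert review; no statement of [claim: Hironaka2017] is used. [folklore]
-/

-- single-problem summit: the doubled namespace component is forced
set_option linter.dupNamespace false

namespace Summit.ResolutionOfSingularities.ResolutionOfSingularities.Theorems.FInjectiveMacaulayfication.G1CornerVeroneseSplitting

/-- **Coordinate splitting** for `w = (2,6,9)`, `N = 18`: if `(K+1)·18 ≤ 2a₀ + 6a₁ + 9a₂` then `(a₀,a₁,a₂) = b + c` with
`18 ≤ w·b` and `K·18 ≤ w·c` — peel `x⁹`, `y³` or `z²`; in the remaining box (`a₀ ≤ 8, a₁ ≤ 2, a₂ ≤ 1`, weight `≤ 37`)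
`K ≤ 1`, and for `K = 1` the block `x³y²` (weight exactly `18`) divides. [folklore] -/
-- adapted from `BP237VeroneseSplitting.coord_split` (weights `(14,6,21)`, `N = 84`)
theorem coord_split (K a₀ a₁ a₂ : ℕ) (h : (K + 1) * 18 ≤ 2 * a₀ + 6 * a₁ + 9 * a₂) :
    ∃ b₀ b₁ b₂ c₀ c₁ c₂ : ℕ, a₀ = b₀ + c₀ ∧ a₁ = b₁ + c₁ ∧ a₂ = b₂ + c₂ ∧
      18 ≤ 2 * b₀ + 6 * b₁ + 9 * b₂ ∧ K * 18 ≤ 2 * c₀ + 6 * c₁ + 9 * c₂ := by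
  by_cases h₀ : 9 ≤ a₀
  · exact ⟨9, 0, 0, a₀ - 9, a₁, a₂, by omega⟩
  by_cases h₁ : 3 ≤ a₁
  · exact ⟨0, 3, 0, a₀, a₁ - 3, a₂, by omega⟩
  by_cases h₂ : 2 ≤ a₂
  · exact ⟨0, 0, 2, a₀, a₁, a₂ - 2, by omega⟩
  -- the box `a₀ ≤ 8, a₁ ≤ 2, a₂ ≤ 1`: weight `≤ 37`, hence `K ≤ 1`
  rcases Nat.eq_zero_or_pos K with rfl | hK
  · exact ⟨a₀, a₁, a₂, 0, 0, 0, by omega⟩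
  -- `K = 1`, weight `≥ 36`: then `a = (8,2,1)` and `x³y²` divides
  by_cases hA : 3 ≤ a₀ ∧ 2 ≤ a₁
  · exact ⟨3, 2, 0, a₀ - 3, a₁ - 2, a₂, by omega⟩
  exfalso
  omega

/-- The `(2,6,9)`-weighted degree of `f : Fin 3 →₀ ℕ` in coordinates: `Finsupp.weight ![2,6,9] f = 2 f₀ + 6 f₁ + 9 f₂`.
[folklore] -/
theorem weight_eq (f : Fin 3 →₀ ℕ) :
    Finsupp.weight (![2, 6, 9] : Fin 3 → ℕ) f = 2 * f 0 + 6 * f 1 + 9 * f 2 := by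
  rw [Finsupp.weight_apply,
    Finsupp.sum_fintype f (fun i c => c • (![2, 6, 9] : Fin 3 → ℕ) i) (fun _ => zero_smul ℕ _),
    Fin.sum_univ_three]
  simp only [smul_eq_mul, Matrix.cons_val_zero, Matrix.cons_val_one, Matrix.cons_val]
  ring

/-- **Exponent-vector splitting**: if `(K+1)·18 ≤ weight ![2,6,9] a` then `a = b + c` with `18 ≤ weight b` and
`K·18 ≤ weight c` (`coord_split` along `Finsupp.equivFunOnFinite`). [folklore] -/
theorem finsupp_split (K : ℕ) (a : Fin 3 →₀ ℕ)
    (ha : (K + 1) * 18 ≤ Finsupp.weight (![2, 6, 9] : Fin 3 → ℕ) a) :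
    ∃ b c : Fin 3 →₀ ℕ, a = b + c ∧ 18 ≤ Finsupp.weight (![2, 6, 9] : Fin 3 → ℕ) b ∧
      K * 18 ≤ Finsupp.weight (![2, 6, 9] : Fin 3 → ℕ) c := by
  rw [weight_eq] at ha
  obtain ⟨b₀, b₁, b₂, c₀, c₁, c₂, e₀, e₁, e₂, hb, hc⟩ := coord_split K (a 0) (a 1) (a 2) ha
  refine ⟨Finsupp.equivFunOnFinite.symm ![b₀, b₁, b₂], Finsupp.equivFunOnFinite.symm ![c₀, c₁, c₂],
    ?_, ?_, ?_⟩
  · ext i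
    fin_cases i <;> simp [e₀, e₁, e₂]
  · rw [weight_eq]
    simpa using hb
  · rw [weight_eq]
    simpa using hc

/-- **VERONESE SPLITTING for `w = (2,6,9)`, `N = 18`** (the saturation hypothesis `hpow` of the graded engine G5 at the
corner-G1 data): every monomial of weighted degree `≥ 18K` lies in `I₁₈^K`, `I₁₈` the ideal spanned by the monomials of
weighted degree `≥ 18`. Induction on `K` via `finsupp_split`, `MvPolynomial.monomial_mul`, `Ideal.mul_mem_mul`. [folklore] -/
theorem g1CornerVeroneseSplitting : ∀ (k : Type) [Field k] (K : ℕ) (b : Fin 3 →₀ ℕ),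
    K * 18 ≤ Finsupp.weight (![2, 6, 9] : Fin 3 → ℕ) b →
    (MvPolynomial.monomial b (1 : k) : MvPolynomial (Fin 3) k) ∈
      (Ideal.span {m : MvPolynomial (Fin 3) k | ∃ b : Fin 3 →₀ ℕ,
        18 ≤ Finsupp.weight (![2, 6, 9] : Fin 3 → ℕ) b ∧ m = MvPolynomial.monomial b 1}) ^ K := by
  intro k _ K
  induction K with
  | zero =>
    intro a _
    rw [pow_zero, Ideal.one_eq_top]
    exact Submodule.mem_top
  | succ K ih =>
    intro a ha
    obtain ⟨b, c, rfl, hb, hc⟩ := finsupp_split K a ha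
    have hmul : (MvPolynomial.monomial (b + c) (1 : k) : MvPolynomial (Fin 3) k) =
        MvPolynomial.monomial b 1 * MvPolynomial.monomial c 1 := by
      rw [MvPolynomial.monomial_mul, one_mul]
    rw [pow_succ', hmul]
    exact Ideal.mul_mem_mul (Ideal.subset_span ⟨b, hb, rfl⟩) (ih c hc)

end Summit.ResolutionOfSingularities.ResolutionOfSingularities.Theorems.FInjectiveMacaulayfication.G1CornerVeroneseSplitting
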